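import Summits.BirchSwinnertonDyer.BirchSwinnertonDyer.Theorems.KatoDescentPotSupersingularKatoFiniteLevelStrictSurj
import HarnessLib

/-!
# Lifting a class of `H¹(K, E[p^∞])` UNRAMIFIED OUTSIDE `P` (no condition at `P`) to a class of `H¹(K, E[p^{m+e}])`
# unramified outside `P` — the lift behind Kato's `S(E[p^∞])` (Kummer at `p`, unramified at `ℓ ≠ p`)
# (route `KatoDescentPotSupersingular` / `…Tame…`, crux M = stmt-BirchSwinnertonDyer-19196; route-free helper)

Seat `bsd-potss-rkm` g19 (prover; cell `bsd-potss`), item stmt-BirchSwinnertonDyer-19196 (`--supports … --as helper`; closes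
nothing).  HONEST FRAMING: BSD is not proved by any of this; nothing is booked; theorems only (no definition, no named fact):
TOOL theorems of Galois cohomology of elliptic curves over number fields.

## Why (brick (a) of crux M's level-0 ledger, step L2 of memo `HOME/rkm/FINDING-19196-rkm-g18.md` §ARCHITECTURE)

Kato's group `S(E[p^∞]) ≤ H¹(ℚ, E[p^∞])` (Astérisque 295, §14.8: Kummer condition at `p`, UNRAMIFIED at every `ℓ ≠ p`) is counted
through a finite level: every `c ∈ S` killed by `p^m` must be written `c = ι_{m+e} c'` with `c' ∈ H¹(ℚ, E[p^{m+e}])` UNRAMIFIED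
at every `ℓ ≠ p` (the Kummer condition at `p` for `c'` then comes for free from that of `c`, since the local Kummer condition
is the kernel of `H¹(ℚ_p, E[p^{m+e}]) → H¹(ℚ_p, E)` and this map factors through `ι_{m+e}`).  Seat g17's part 4
(`…KatoFiniteLevelStrictSurj`, `exists_mem_selmerGroup_strict_map_primaryInclusion_eq`) proved exactly this lift for Kato's
STRICT structure (zero at the places of `P`); the cocycle argument at the places `v ∉ P` does not look at `P` at all, and this
file records the lift with NO condition at `P` — the form brick (a) consumes:

* **`exists_map_primaryInclusion_eq_of_unramified_outside`** — `W` elliptic over a number field `K`, `p` prime, `P` any finset of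
  finite places, `c ∈ H¹(K, E[p^∞])` with `p^m · c = 0` whose localisations at the finite `v ∉ P` are unramified; (hN) at every
  finite `v ∉ P`, `p^e · (E[p^∞])^{I_v}` is `p^m`-divisible inside `(E[p^∞])^{I_v}` (`∀ x ∃ d, p^{m+e} d = p^e x`; discharged for
  `e ≫ 0` by g17's `exists_forall_hN`).  THEN `c = ι_{m+e} c'` for a class `c' ∈ H¹(K, E[p^{m+e}])` unramified at every finite
  `v ∉ P` — namely `c' = (levelIncl)_* c_m` for ANY `c_m` with `ι_m c_m = c`.  Proof = g17's cocycle computation at `v ∉ P`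
  verbatim: `loc_v c = [ι_m ∘ ψ]` unramified gives `ι(ψ τ) = τW − W` on `I_v`, `x = p^m W` is `I_v`-fixed, (hN) gives `d` with
  `p^{m+e} d = p^e x`, and `W − d ∈ E[p^{m+e}]` trivialises the pushed cocycle on `I_v`.
* **`exists_mem_selmerGroup_top_map_primaryInclusion_eq`** — the same in Selmer-structure form: for structures `𝓤` on
  `E[p^{m+e}]` and `𝓤∞` on `E[p^∞]` that are `⊤` at the places of `P`, UNRAMIFIED at the finite `v ∉ P` and `⊤` at infinity,
  every `c ∈ H¹_{𝓤∞}` with `p^m c = 0` is `ι_{m+e} c'` with `c' ∈ H¹_𝓤` (`p` odd is not even needed here).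

References: K. Kato, Astérisque 295 (2004) §14.8 (p. 238), proof of Prop. 14.16 (pp. 244–245) [Kato2004Asterisque]; R. Greenberg,
LNM 1716 (1999) §5 proof of Prop. 5.8, §3 Lemma 3.3 [GreenbergLNM1716]; J. H. Silverman, *AEC* VIII §2 [SilvermanAEC2009].
-/

-- the summit and its single problem are both named `BirchSwinnertonDyer` (registry layout D-0017)
set_option linter.dupNamespace false
set_option autoImplicit false

noncomputable section

open scoped Classical ContRepresentation NumberField
open Function Field NumberField IsDedekindDomain WeierstrassCurve
open Literature.NumberTheory.EllipticCurves Literature.NumberTheory.GaloisRepresentations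
  Literature.NumberTheory.GaloisRepresentations.DiscreteGaloisModule Literature.NumberTheory.GaloisCohomology
open Summit.BirchSwinnertonDyer.Rank1Residual.X11b.Levels Summit.BirchSwinnertonDyer.Rank1Residual.X11b.LocBridge
open Summit.BirchSwinnertonDyer.Rank1Residual.GaloisImage

universe u

namespace Summit.BirchSwinnertonDyer.BirchSwinnertonDyer.Theorems.KatoFiniteLevelCount

section Lift

variable {K : Type u} [Field K] [NumberField K] (W : WeierstrassCurve K) [W.IsElliptic] (p : ℕ) [Fact p.Prime]
  (m e : ℕ) (P : Finset (HeightOneSpectrum (𝓞 K)))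

/-- **Lifting a class of `E[p^∞]` unramified outside `P` to a class of `E[p^{m+e}]` unramified outside `P`.**  For
`c ∈ H¹(K, E[p^∞])` with `p^m · c = 0` and `loc_v c ∈ H¹_ur(K_v, E[p^∞])` at every finite `v ∉ P` (NO condition at the places of
`P`), granted (hN) at every finite `v ∉ P` (`p^e · (E[p^∞])^{I_v}` is `p^m`-divisible inside `(E[p^∞])^{I_v}`), there is
`c' ∈ H¹(K, E[p^{m+e}])` with `ι_{m+e} c' = c` and `loc_v c' ∈ H¹_ur(K_v, E[p^{m+e}])` at every finite `v ∉ P`.  The cocycle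
proof is seat g17's (`exists_mem_selmerGroup_strict_map_primaryInclusion_eq`) at the places `v ∉ P`.
[cite: GreenbergLNM1716, §5 proof of Prop. 5.8 and §3 Lemma 3.3] [cite: Kato2004Asterisque, 14.8 and (14.9.3) (pp. 238–240)] -/
theorem exists_map_primaryInclusion_eq_of_unramified_outside
    (hN : ∀ v : HeightOneSpectrum (𝓞 K), v ∉ P → ∀ x : W.geomPrimaryTorsion p,
      (∀ τ ∈ absInertia (v.adicCompletion K), GaloisRep.toLocal v (primaryGaloisModule W p) τ x = x) →
        ∃ d : W.geomPrimaryTorsion p,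
          (∀ τ ∈ absInertia (v.adicCompletion K), GaloisRep.toLocal v (primaryGaloisModule W p) τ d = d) ∧
            p ^ (m + e) • d = p ^ e • x)
    {c : galoisCohomology (primaryGaloisModule W p) 1}
    (hcur : ∀ v : HeightOneSpectrum (𝓞 K), v ∉ P →
      galoisCohomology.localization (primaryGaloisModule W p) (Sum.inr v) 1 c ∈
        unramifiedSubgroup (GaloisRep.toLocal v (primaryGaloisModule W p)) 1)
    (hm : p ^ m • c = 0) :
    ∃ c' : galoisCohomology (W.torsionGaloisModule ((p ^ (m + e) : ℕ) : ℤ)) 1,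
      galoisCohomology.map (primaryInclusion W p (m + e)) 1 c' = c ∧
      ∀ v : HeightOneSpectrum (𝓞 K), v ∉ P →
        galoisCohomology.localization (W.torsionGaloisModule ((p ^ (m + e) : ℕ) : ℤ)) (Sum.inr v) 1 c' ∈
          unramifiedSubgroup (GaloisRep.toLocal v (W.torsionGaloisModule ((p ^ (m + e) : ℕ) : ℤ))) 1 := by
  have hdiv : W.zsmul_geomPoints_surjective := W.zsmul_geomPoints_surjective_holds
  -- `c = ι_m c_m`
  obtain ⟨cm, hcm⟩ := (mem_range_map_primaryInclusion_iff W p m hdiv c).2 hm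
  refine ⟨galoisCohomology.map (levelIncl W p m e) 1 cm, by rw [map_primaryInclusion_map_levelIncl, hcm], fun v hv => ?_⟩
  -- a cocycle `ψ` for `loc_v c_m`; `loc_v` of the pushed class is `[levelIncl ∘ ψ]`
  obtain ⟨ψ, hψ⟩ := oneCocycleClass_surjective _ (galoisCohomology.localization _ (Sum.inr v) 1 cm)
  set ψ' := contOneCocycles.pullback (ContinuousMonoidHom.id _)
    (X := DiscreteGaloisModule.toTopRep ((W.torsionGaloisModule ((p ^ m : ℕ) : ℤ)).toLocal (Sum.inr v)))
    (Y := DiscreteGaloisModule.toTopRep ((W.torsionGaloisModule ((p ^ (m + e) : ℕ) : ℤ)).toLocal (Sum.inr v)))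
    (TopRep.ofHom ⟨((levelIncl W p m e).restrictField (Place.Completion (Sum.inr v : Place K))).toContinuousLinearMap,
      ((levelIncl W p m e).restrictField (Place.Completion (Sum.inr v : Place K))).isIntertwining'⟩) ψ with hψ'
  have hpush : galoisCohomology.localization _ (Sum.inr v) 1 (galoisCohomology.map (levelIncl W p m e) 1 cm) =
      oneCocycleClass _ ψ' := by
    rw [localization_map_one', ← hψ]
    exact galoisCohomology.map_one_oneCocycleClass _ ψ
  rw [hpush]
  -- `loc_v c = [ι_m ∘ ψ]`
  set ψι := contOneCocycles.pullback (ContinuousMonoidHom.id _)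
    (X := DiscreteGaloisModule.toTopRep ((W.torsionGaloisModule ((p ^ m : ℕ) : ℤ)).toLocal (Sum.inr v)))
    (Y := DiscreteGaloisModule.toTopRep ((primaryGaloisModule W p).toLocal (Sum.inr v)))
    (TopRep.ofHom ⟨((primaryInclusion W p m).restrictField (Place.Completion (Sum.inr v : Place K))).toContinuousLinearMap,
      ((primaryInclusion W p m).restrictField (Place.Completion (Sum.inr v : Place K))).isIntertwining'⟩) ψ with hψι
  have hcv : galoisCohomology.localization _ (Sum.inr v) 1 c = oneCocycleClass _ ψι := by
    rw [← hcm, localization_map_one', ← hψ]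
    exact galoisCohomology.map_one_oneCocycleClass _ ψ
  -- values of the two pulled-back cocycles
  have hψ'_apply : ∀ σ, (ψ'.1 σ : W.geomTorsion ((p ^ (m + e) : ℕ) : ℤ)) = levelIncl W p m e (ψ.1 σ) := fun σ => rfl
  have hψι_apply : ∀ σ, (ψι.1 σ : W.geomPrimaryTorsion p) = primaryInclusion W p m (ψ.1 σ) := fun σ => rfl
  -- the Galois action on `E[p^∞]|_{K_v}` commutes with `ι`
  have hι : ∀ (k : ℕ) (σ : absoluteGaloisGroup (v.adicCompletion K)) (T : W.geomTorsion ((p ^ k : ℕ) : ℤ)),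
      primaryInclusion W p k (GaloisRep.toLocal v (W.torsionGaloisModule ((p ^ k : ℕ) : ℤ)) σ T) =
        GaloisRep.toLocal v (primaryGaloisModule W p) σ (primaryInclusion W p k T) := by
    intro k σ T
    have h := ((primaryInclusion W p k).restrictField (v.adicCompletion K)).isIntertwining σ T
    rwa [ContinuousRep.toContRepresentation_apply_apply, ContinuousRep.toContRepresentation_apply_apply,
      ContIntertwiningMap.restrictField_apply, ContIntertwiningMap.restrictField_apply] at h
  -- `p^m • (σ Wpt − Wpt) = 0` whenever `ι_m (ψ σ) = σ Wpt − Wpt`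
  have hfixW : ∀ (σ : absoluteGaloisGroup (v.adicCompletion K)) (Wpt : W.geomPrimaryTorsion p),
      primaryInclusion W p m (ψ.1 σ) = GaloisRep.toLocal v (primaryGaloisModule W p) σ Wpt - Wpt →
        GaloisRep.toLocal v (primaryGaloisModule W p) σ (p ^ m • Wpt) = p ^ m • Wpt := by
    intro σ Wpt h
    have h2 : p ^ m • (GaloisRep.toLocal v (primaryGaloisModule W p) σ Wpt - Wpt) = 0 := by
      rw [← h, ← map_nsmul, pow_nsmul_geomTorsion_eq_zero, map_zero]
    rw [smul_sub, ← map_nsmul, sub_eq_zero] at h2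
    exact h2
  -- finite `v ∉ P`: `loc_v c` unramified
  have hur := hcur v hv
  rw [hcv] at hur
  obtain ⟨Wpt, hW⟩ := (Rank1Residual.X11b.LocBridge.mem_unramifiedSubgroup_one_iff_exists
    (GaloisRep.toLocal v (primaryGaloisModule W p)) ψι).mp hur
  have hW' : ∀ τ ∈ absInertia (v.adicCompletion K),
      primaryInclusion W p m (ψ.1 τ) = GaloisRep.toLocal v (primaryGaloisModule W p) τ Wpt - Wpt :=
    fun τ hτ => (hψι_apply τ).symm.trans (hW τ hτ)
  -- `x = p^m Wpt` is `I_v`-fixed; take `d` from (hN)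
  obtain ⟨d, hd, hdx⟩ := hN v hv (p ^ m • Wpt) fun τ hτ => hfixW τ Wpt (hW' τ hτ)
  -- `W' = Wpt - d ∈ E[p^{m+e}]`
  have hkill : p ^ (m + e) • (Wpt - d) = 0 := by
    rw [smul_sub, hdx, add_comm, pow_add, mul_smul, sub_self]
  obtain ⟨w, hw⟩ := exists_primaryInclusion_eq_of_nsmul_eq_zero W p (m + e) (Wpt - d) hkill
  refine (Rank1Residual.X11b.LocBridge.mem_unramifiedSubgroup_one_iff_exists
    (GaloisRep.toLocal v (W.torsionGaloisModule ((p ^ (m + e) : ℕ) : ℤ))) ψ').mpr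
    ⟨w, fun τ hτ => primaryInclusion_injective W p (m + e) ?_⟩
  change primaryInclusion W p (m + e) (levelIncl W p m e (ψ.1 τ)) =
    primaryInclusion W p (m + e)
      (GaloisRep.toLocal v (W.torsionGaloisModule ((p ^ (m + e) : ℕ) : ℤ)) τ w - w)
  rw [map_sub, primaryInclusion_levelIncl, hι, hw, map_sub, hd τ hτ, hW' τ hτ]
  abel

variable (𝓤 : SelmerStructure (W.torsionGaloisModule ((p ^ (m + e) : ℕ) : ℤ))) (𝓤inf : SelmerStructure (primaryGaloisModule W p))

/-- **Selmer-structure form.**  For structures `𝓤` on `E[p^{m+e}]` and `𝓤∞` on `E[p^∞]` which are `⊤` at the places of `P`,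
UNRAMIFIED at the finite places `v ∉ P` and `⊤` at the infinite places: every `c ∈ H¹_{𝓤∞}(K, E[p^∞])` with `p^m · c = 0` is
`ι_{m+e} c'` for some `c' ∈ H¹_𝓤(K, E[p^{m+e}])`, granted (hN) at the finite `v ∉ P`.  (With `P ⊇ {v ∣ p}` and the Kummer
condition imposed separately at `P`, `H¹_{𝓤∞}` ⊇ Kato's `S(E[p^∞])`.)
[cite: Kato2004Asterisque, §14.8 (p. 238) and proof of Prop. 14.16 (pp. 244–245)] [cite: GreenbergLNM1716, §5 proof of Prop. 5.8] -/
theorem exists_mem_selmerGroup_top_map_primaryInclusion_eq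
    (h𝓤P : ∀ v ∈ P, 𝓤 (Sum.inr v) = ⊤)
    (h𝓤ur : ∀ v ∉ P, 𝓤 (Sum.inr v) =
      unramifiedSubgroup (GaloisRep.toLocal v (W.torsionGaloisModule ((p ^ (m + e) : ℕ) : ℤ))) 1)
    (h𝓤inl : ∀ w : InfinitePlace K, 𝓤 (Sum.inl w) = ⊤)
    (hIur : ∀ v ∉ P, 𝓤inf (Sum.inr v) = unramifiedSubgroup (GaloisRep.toLocal v (primaryGaloisModule W p)) 1)
    (hN : ∀ v : HeightOneSpectrum (𝓞 K), v ∉ P → ∀ x : W.geomPrimaryTorsion p,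
      (∀ τ ∈ absInertia (v.adicCompletion K), GaloisRep.toLocal v (primaryGaloisModule W p) τ x = x) →
        ∃ d : W.geomPrimaryTorsion p,
          (∀ τ ∈ absInertia (v.adicCompletion K), GaloisRep.toLocal v (primaryGaloisModule W p) τ d = d) ∧
            p ^ (m + e) • d = p ^ e • x)
    {c : galoisCohomology (primaryGaloisModule W p) 1} (hc : c ∈ 𝓤inf.selmerGroup) (hm : p ^ m • c = 0) :
    ∃ c' ∈ 𝓤.selmerGroup, galoisCohomology.map (primaryInclusion W p (m + e)) 1 c' = c := by
  have hcS := (SelmerStructure.mem_selmerGroup_iff _ _).1 hc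
  obtain ⟨c', hc'c, hc'ur⟩ := exists_map_primaryInclusion_eq_of_unramified_outside W p m e P hN
    (fun v hv => by have h := hcS (Sum.inr v); rwa [hIur v hv] at h) hm
  refine ⟨c', (SelmerStructure.mem_selmerGroup_iff _ _).2 fun v => ?_, hc'c⟩
  rcases v with w | v
  · rw [h𝓤inl w]; exact AddSubgroup.mem_top _
  · by_cases hv : v ∈ P
    · rw [h𝓤P v hv]; exact AddSubgroup.mem_top _
    · rw [h𝓤ur v hv]; exact hc'ur v hv

end Lift

end Summit.BirchSwinnertonDyer.BirchSwinnertonDyer.Theorems.KatoFiniteLevelCount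

end
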